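import Summits.QuantumFields.YangMills.Theorems.QuantileBitPuritySectors
import Summits.QuantumFields.YangMills.Theorems.ToronSmallBallLargeFieldCut
import Summits.QuantumFields.YangMills.Theorems.SwapTwistDeficitSmallBallFloors
import HarnessLib

/-!
# Good-field cuts INSIDE one seam sector of the zero-flux ring: large spatial action on any slice, a far link on any bond INCLUDING THE SEAM,
# and their normalisation by the zero-flux trace

Support module (`--supports` stmt-QuantumFields-23948; memo HOME `bc/g14-dw/SECTORS-translates.md` §1: the GOOD event of a sector is «every slice has
small Wilson action and every bond, the seam bond `U_n → g·tw_z U_0` included, is linkwise close»).  For the sector weights `TT.sectorWeight β n z F`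
(defs module `QuantileBitPuritySectorDefs`; `(1/8)Σ_z` of them is the `physAvg`-closed ring, `TT.ringInsTrace_zero_eq_sum_sectorWeight`) we prove the
ring-length-general, sector-resolved form of the tree's 2L-ring cuts (`TT.insTrace_indicator_largeAction_le_floor`, `TT.chain_mul_indicator_far_le`):

* §1 a generic «pointwise bound ⇒ sector-weight bound» lemma and the three pointwise bounds: a slice `t` with action `≥ s` costs
  `e^{−βs/2}·M^{n+1}` (`M = (e^{2β})^{|E|}`; the bond issuing from slice `t` — the SEAM bond when `t = n` — carries `e^{−(β/2)S(U_t)}`), a `t`-far link on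
  an interior bond or ON THE SEAM BOND costs `e^{β(2|E|−t²/2)}·M^{n}` (`FlatSheet.transferKernel_mul_indicator_far_le`);
* §2 the integrated cuts `sectorWeight β n z 𝟙[s ≤ S(U_t)] ≤ e^{−βs/2} M^{n+1}`, `sectorWeight β n z 𝟙[bond i far] ≤ e^{β(2|E|−t²/2)} M^{n}`,
  `sectorWeight β n z 𝟙[seam far] ≤ e^{β(2|E|−t²/2)} M^{n}`;
* §3 the floor `(M β^{−N})^{n+1} ≤ Z_phys(L, β, n+1)` (`N = 8|P| + 97|E|`, `β ≥ max(9, 4/w₀)`, `n ≥ 1`; trace formula + `TT.levelValue_zero_ge_rpow`) and the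
  NORMALISED cuts `≤ e^{−βs/2}(β^N)^{n+1}·Z_phys(n+1)` ∕ `≤ e^{−βt²/2}(β^N)^{n+1}·Z_phys(n+1)`: with `βs/2, βt²/2 ≥ ((n+1)N + a)·log β` the bad events are
  `β^{−a}`-negligible against the zero-flux trace, uniformly over the eight sectors — the complement of the GOOD event of the memo.

HONEST FRAMING: fixed-lattice bookkeeping; no semiclassics/RG; nothing about infinite volume, the continuum limit or the Clay gap.  No `sorry`, no new
axiom, no new definition.  References: [cite: SeilerLNP1982, §3]; [cite: Luscher1983, §2]; [cite: MontvayMunster1994, (3.145)].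
-/

set_option autoImplicit false

noncomputable section

open MeasureTheory Filter Topology Real Function
open scoped BigOperators
open Literature.MathematicalPhysics.QuantumLattice
open Literature.MathematicalPhysics.QuantumFieldTheory hiding SU2
open Summit.QuantumFields.YangMills.Theorems

namespace Summit.QuantumFields.YangMills.Theorems.FemtoTransferGap.TT

open Summit.QuantumFields.YangMills.Theorems.FemtoTransferGap

variable {L : ℕ} [NeZero L]

/-! ## §1 Pointwise bounds on the sector integrand -/

/-- **Pointwise bound ⇒ sector-weight bound**: if `(chain · seam · F)(U⃗, g) ≤ B` everywhere (`F` bounded measurable) then `sectorWeight β n z F ≤ B`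
(both a-priori measures are probability measures). [folklore] -/
theorem sectorWeight_le_of_pointwise (β : ℝ) (n : ℕ) (z : Fin 3 → Bool)
    {F : (Fin (n + 1) → GaugeConfig 3 L SU2) → (Site 3 L → SU2) → ℝ} (hF : Measurable (uncurry F)) {C : ℝ} (hFb : ∀ Us g, |F Us g| ≤ C) {B : ℝ}
    (hB : ∀ (Us : Fin (n + 1) → GaugeConfig 3 L SU2) (g : Site 3 L → SU2),
      (∏ i : Fin n, transferKernel su2Rep β (Us i.castSucc) (Us i.succ)) *
        transferKernel su2Rep β (Us (Fin.last n)) (gaugeTransform g (twist3 z (Us 0))) * F Us g ≤ B) :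
    sectorWeight β n z F ≤ B := by
  haveI := isProbabilityMeasure_gaugeMeasure (L := L)
  have hint : Integrable (fun p : (Fin (n + 1) → GaugeConfig 3 L SU2) × (Site 3 L → SU2) =>
      (∏ i : Fin n, transferKernel su2Rep β (p.1 i.castSucc) (p.1 i.succ)) *
        transferKernel su2Rep β (p.1 (Fin.last n)) (gaugeTransform p.2 (twist3 z (p.1 0))) * F p.1 p.2)
      ((Measure.pi fun _ : Fin (n + 1) => configMeasure SU2 L).prod (gaugeMeasure L)) := integrable_sectorIntegrand (L := L) β n z hF hFb
  rw [sectorWeight_eq_integral_prod β n z hF hFb]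
  calc ∫ p : (Fin (n + 1) → GaugeConfig 3 L SU2) × (Site 3 L → SU2),
        (∏ i : Fin n, transferKernel su2Rep β (p.1 i.castSucc) (p.1 i.succ)) *
          transferKernel su2Rep β (p.1 (Fin.last n)) (gaugeTransform p.2 (twist3 z (p.1 0))) * F p.1 p.2
        ∂((Measure.pi fun _ : Fin (n + 1) => configMeasure SU2 L).prod (gaugeMeasure L))
      ≤ ∫ _p, B ∂((Measure.pi fun _ : Fin (n + 1) => configMeasure SU2 L).prod (gaugeMeasure L)) :=
        integral_mono hint (integrable_const B) fun p => hB p.1 p.2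
    _ = B := by rw [integral_const, probReal_univ, one_smul]

/-- The open chain is at most `M^n`, `M = (e^{2β})^{|E|}` (`β ≥ 0`). [folklore] -/
theorem prod_transferKernel_le_pow {β : ℝ} (hβ : 0 ≤ β) (n : ℕ) (Us : Fin (n + 1) → GaugeConfig 3 L SU2) :
    (∏ i : Fin n, transferKernel su2Rep β (Us i.castSucc) (Us i.succ)) ≤ (Real.exp (2 * β) ^ Fintype.card (Edge 3 L)) ^ n := by
  calc (∏ i : Fin n, transferKernel su2Rep β (Us i.castSucc) (Us i.succ)) ≤ ∏ _i : Fin n, Real.exp (2 * β) ^ Fintype.card (Edge 3 L) :=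
        Finset.prod_le_prod (fun i _ => (transferKernel_pos _ _ _ _).le) fun i _ => (le_abs_self _).trans (abs_transferKernel_le_lat hβ (_, _))
    _ = (Real.exp (2 * β) ^ Fintype.card (Edge 3 L)) ^ n := by rw [Finset.prod_const, Finset.card_univ, Fintype.card_fin]

/-- The open chain with the bond issuing from slice `i.castSucc` singled out: at most `M^{n−1} · M e^{−(β/2)S(U_i)}`. [cite: SeilerLNP1982, §3] -/
theorem prod_transferKernel_le_pow_mul_expAction {β : ℝ} (hβ : 0 ≤ β) {n : ℕ} (i : Fin n) (Us : Fin (n + 1) → GaugeConfig 3 L SU2) :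
    (∏ j : Fin n, transferKernel su2Rep β (Us j.castSucc) (Us j.succ)) ≤
      (Real.exp (2 * β) ^ Fintype.card (Edge 3 L)) ^ (n - 1) *
        (Real.exp (2 * β) ^ Fintype.card (Edge 3 L) * Real.exp (-(β / 2) * wilsonAction su2Rep (Us i.castSucc))) := by
  set M : ℝ := Real.exp (2 * β) ^ Fintype.card (Edge 3 L) with hM
  have hKM : ∀ U V : GaugeConfig 3 L SU2, transferKernel su2Rep β U V ≤ M := fun U V => (le_abs_self _).trans (abs_transferKernel_le_lat hβ (U, V))
  rw [← Finset.mul_prod_erase Finset.univ _ (Finset.mem_univ i)]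
  have hrest : ∏ j ∈ Finset.univ.erase i, transferKernel su2Rep β (Us j.castSucc) (Us j.succ) ≤ M ^ (n - 1) := by
    calc ∏ j ∈ Finset.univ.erase i, transferKernel su2Rep β (Us j.castSucc) (Us j.succ) ≤ ∏ _j ∈ Finset.univ.erase i, M :=
          Finset.prod_le_prod (fun j _ => (transferKernel_pos _ _ _ _).le) fun j _ => hKM _ _
      _ = M ^ (n - 1) := by rw [Finset.prod_const, Finset.card_erase_of_mem (Finset.mem_univ _), Finset.card_univ, Fintype.card_fin]
  have hrest0 : 0 ≤ ∏ j ∈ Finset.univ.erase i, transferKernel su2Rep β (Us j.castSucc) (Us j.succ) :=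
    Finset.prod_nonneg fun j _ => (transferKernel_pos _ _ _ _).le
  rw [mul_comm]
  exact mul_le_mul hrest (transferKernel_le_exp_mul_expAction_left hβ _ _) (transferKernel_pos _ _ _ _).le (by positivity)

/-- **Pointwise large-action cut**: a slice `t` with `s ≤ S(U_t)` makes the sector integrand at most `e^{−βs/2}·M^{n}·M` — the bond ISSUING from
slice `t` (the seam bond if `t = n`) carries the factor `e^{−(β/2)S(U_t)}`. [cite: SeilerLNP1982, §3] [cite: Luscher1983, §2] -/
theorem seamChain_mul_indicator_largeAction_le {β : ℝ} (hβ : 0 ≤ β) (n : ℕ) (z : Fin 3 → Bool) (s : ℝ) (t : Fin (n + 1))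
    (Us : Fin (n + 1) → GaugeConfig 3 L SU2) (g : Site 3 L → SU2) :
    (∏ i : Fin n, transferKernel su2Rep β (Us i.castSucc) (Us i.succ)) *
        transferKernel su2Rep β (Us (Fin.last n)) (gaugeTransform g (twist3 z (Us 0))) *
        Set.indicator {U : GaugeConfig 3 L SU2 | s ≤ wilsonAction su2Rep U} (fun _ => (1 : ℝ)) (Us t) ≤
      Real.exp (-(β / 2 * s)) * (Real.exp (2 * β) ^ Fintype.card (Edge 3 L)) ^ n * Real.exp (2 * β) ^ Fintype.card (Edge 3 L) := by
  set M : ℝ := Real.exp (2 * β) ^ Fintype.card (Edge 3 L) with hM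
  have hM0 : 0 ≤ M := by positivity
  have hKM : ∀ U V : GaugeConfig 3 L SU2, transferKernel su2Rep β U V ≤ M := fun U V => (le_abs_self _).trans (abs_transferKernel_le_lat hβ (U, V))
  have hP0 : 0 ≤ ∏ i : Fin n, transferKernel su2Rep β (Us i.castSucc) (Us i.succ) := Finset.prod_nonneg fun i _ => (transferKernel_pos _ _ _ _).le
  have hS0 := transferKernel_pos su2Rep β (Us (Fin.last n)) (gaugeTransform g (twist3 z (Us 0)))
  by_cases hmem : Us t ∈ {U : GaugeConfig 3 L SU2 | s ≤ wilsonAction su2Rep U}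
  · rw [Set.indicator_of_mem hmem, mul_one]
    have hs : s ≤ wilsonAction su2Rep (Us t) := hmem
    have hexp : Real.exp (-(β / 2) * wilsonAction su2Rep (Us t)) ≤ Real.exp (-(β / 2 * s)) := Real.exp_le_exp.2 (by nlinarith)
    -- which bond issues from slice `t`?
    rcases Fin.eq_castSucc_or_eq_last t with ⟨i, rfl⟩ | rfl
    · -- interior bond `i`
      have h1 := prod_transferKernel_le_pow_mul_expAction (L := L) hβ i Us
      calc (∏ j : Fin n, transferKernel su2Rep β (Us j.castSucc) (Us j.succ)) *
            transferKernel su2Rep β (Us (Fin.last n)) (gaugeTransform g (twist3 z (Us 0)))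
          ≤ (M ^ (n - 1) * (M * Real.exp (-(β / 2) * wilsonAction su2Rep (Us i.castSucc)))) * M := mul_le_mul h1 (hKM _ _) hS0.le (by positivity)
        _ ≤ (M ^ (n - 1) * (M * Real.exp (-(β / 2 * s)))) * M := by gcongr
        _ = Real.exp (-(β / 2 * s)) * (M ^ (n - 1) * M) * M := by ring
        _ = Real.exp (-(β / 2 * s)) * M ^ n * M := by
            have hn : n - 1 + 1 = n := by have := i.isLt; omega
            rw [← pow_succ, hn]
    · -- the seam bond
      have h1 := prod_transferKernel_le_pow (L := L) hβ n Us
      have h2 : transferKernel su2Rep β (Us (Fin.last n)) (gaugeTransform g (twist3 z (Us 0))) ≤ M * Real.exp (-(β / 2 * s)) :=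
        (transferKernel_le_exp_mul_expAction_left hβ _ _).trans (mul_le_mul_of_nonneg_left hexp hM0)
      calc (∏ j : Fin n, transferKernel su2Rep β (Us j.castSucc) (Us j.succ)) *
            transferKernel su2Rep β (Us (Fin.last n)) (gaugeTransform g (twist3 z (Us 0)))
          ≤ M ^ n * (M * Real.exp (-(β / 2 * s))) := mul_le_mul h1 h2 hS0.le (by positivity)
        _ = Real.exp (-(β / 2 * s)) * M ^ n * M := by ring
  · rw [Set.indicator_of_notMem hmem, mul_zero]
    positivity

/-- **Pointwise far-link cut on an interior bond**: a `t`-far link on bond `i` makes the sector integrand at most `e^{β(2|E|−t²/2)}·M^{n}`.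
[cite: SeilerLNP1982, §3] -/
theorem seamChain_mul_indicator_far_le {β : ℝ} (hβ : 0 ≤ β) {t : ℝ} (ht : 0 ≤ t) {n : ℕ} (z : Fin 3 → Bool) (i : Fin n)
    (Us : Fin (n + 1) → GaugeConfig 3 L SU2) (g : Site 3 L → SU2) :
    (∏ j : Fin n, transferKernel su2Rep β (Us j.castSucc) (Us j.succ)) *
        transferKernel su2Rep β (Us (Fin.last n)) (gaugeTransform g (twist3 z (Us 0))) *
        Set.indicator {p : GaugeConfig 3 L SU2 × GaugeConfig 3 L SU2 |
          ∃ e, t < frobNorm ((p.1 e : Matrix (Fin 2) (Fin 2) ℂ) - (p.2 e : Matrix (Fin 2) (Fin 2) ℂ))} (fun _ => (1 : ℝ)) (Us i.castSucc, Us i.succ) ≤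
      Real.exp (β * (2 * (Fintype.card (Edge 3 L) : ℝ) - t ^ 2 / 2)) * (Real.exp (2 * β) ^ Fintype.card (Edge 3 L)) ^ n := by
  set M : ℝ := Real.exp (2 * β) ^ Fintype.card (Edge 3 L) with hM
  set η : ℝ := Real.exp (β * (2 * (Fintype.card (Edge 3 L) : ℝ) - t ^ 2 / 2)) with hη
  set D : Set (GaugeConfig 3 L SU2 × GaugeConfig 3 L SU2) :=
    {p | ∃ e, t < frobNorm ((p.1 e : Matrix (Fin 2) (Fin 2) ℂ) - (p.2 e : Matrix (Fin 2) (Fin 2) ℂ))} with hDdef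
  have hKM : ∀ U V : GaugeConfig 3 L SU2, transferKernel su2Rep β U V ≤ M := fun U V => (le_abs_self _).trans (abs_transferKernel_le_lat hβ (U, V))
  have hsplit : (∏ j : Fin n, transferKernel su2Rep β (Us j.castSucc) (Us j.succ)) =
      transferKernel su2Rep β (Us i.castSucc) (Us i.succ) * ∏ j ∈ Finset.univ.erase i, transferKernel su2Rep β (Us j.castSucc) (Us j.succ) := by
    rw [← Finset.mul_prod_erase Finset.univ _ (Finset.mem_univ i)]
  have hrest : ∏ j ∈ Finset.univ.erase i, transferKernel su2Rep β (Us j.castSucc) (Us j.succ) ≤ M ^ (n - 1) := by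
    calc ∏ j ∈ Finset.univ.erase i, transferKernel su2Rep β (Us j.castSucc) (Us j.succ) ≤ ∏ _j ∈ Finset.univ.erase i, M :=
          Finset.prod_le_prod (fun j _ => (transferKernel_pos _ _ _ _).le) fun j _ => hKM _ _
      _ = M ^ (n - 1) := by rw [Finset.prod_const, Finset.card_erase_of_mem (Finset.mem_univ _), Finset.card_univ, Fintype.card_fin]
  have hrest0 : 0 ≤ ∏ j ∈ Finset.univ.erase i, transferKernel su2Rep β (Us j.castSucc) (Us j.succ) :=
    Finset.prod_nonneg fun j _ => (transferKernel_pos _ _ _ _).le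
  have hKD : transferKernel su2Rep β (Us i.castSucc) (Us i.succ) * D.indicator (fun _ => (1 : ℝ)) (Us i.castSucc, Us i.succ) ≤ η := by
    simpa only [hDdef, hη] using FlatSheet.transferKernel_mul_indicator_far_le hβ ht (Us i.castSucc) (Us i.succ)
  have hS0 := transferKernel_pos su2Rep β (Us (Fin.last n)) (gaugeTransform g (twist3 z (Us 0)))
  have hn : n - 1 + 1 = n := by have := i.isLt; omega
  calc (∏ j : Fin n, transferKernel su2Rep β (Us j.castSucc) (Us j.succ)) *
          transferKernel su2Rep β (Us (Fin.last n)) (gaugeTransform g (twist3 z (Us 0))) * D.indicator (fun _ => (1 : ℝ)) (Us i.castSucc, Us i.succ)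
      = (transferKernel su2Rep β (Us i.castSucc) (Us i.succ) * D.indicator (fun _ => (1 : ℝ)) (Us i.castSucc, Us i.succ)) *
          (∏ j ∈ Finset.univ.erase i, transferKernel su2Rep β (Us j.castSucc) (Us j.succ)) *
          transferKernel su2Rep β (Us (Fin.last n)) (gaugeTransform g (twist3 z (Us 0))) := by rw [hsplit]; ring
    _ ≤ η * M ^ (n - 1) * M := mul_le_mul (mul_le_mul hKD hrest hrest0 (Real.exp_pos _).le) (hKM _ _) hS0.le (by positivity)
    _ = η * M ^ n := by rw [mul_assoc, ← pow_succ, hn]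

/-- **Pointwise far-link cut ON THE SEAM BOND**: a `t`-far link between `U_n` and `g·tw_z U_0` makes the sector integrand at most `e^{β(2|E|−t²/2)}·M^{n}`.
[cite: SeilerLNP1982, §3] [cite: tHooft1979] -/
theorem seamChain_mul_indicator_seamFar_le {β : ℝ} (hβ : 0 ≤ β) {t : ℝ} (ht : 0 ≤ t) (n : ℕ) (z : Fin 3 → Bool)
    (Us : Fin (n + 1) → GaugeConfig 3 L SU2) (g : Site 3 L → SU2) :
    (∏ j : Fin n, transferKernel su2Rep β (Us j.castSucc) (Us j.succ)) *
        transferKernel su2Rep β (Us (Fin.last n)) (gaugeTransform g (twist3 z (Us 0))) *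
        Set.indicator {p : GaugeConfig 3 L SU2 × GaugeConfig 3 L SU2 |
          ∃ e, t < frobNorm ((p.1 e : Matrix (Fin 2) (Fin 2) ℂ) - (p.2 e : Matrix (Fin 2) (Fin 2) ℂ))} (fun _ => (1 : ℝ))
          (Us (Fin.last n), gaugeTransform g (twist3 z (Us 0))) ≤
      Real.exp (β * (2 * (Fintype.card (Edge 3 L) : ℝ) - t ^ 2 / 2)) * (Real.exp (2 * β) ^ Fintype.card (Edge 3 L)) ^ n := by
  have h1 := prod_transferKernel_le_pow (L := L) hβ n Us
  have h2 := FlatSheet.transferKernel_mul_indicator_far_le hβ ht (Us (Fin.last n)) (gaugeTransform g (twist3 z (Us 0)))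
  have hP0 : 0 ≤ ∏ i : Fin n, transferKernel su2Rep β (Us i.castSucc) (Us i.succ) := Finset.prod_nonneg fun i _ => (transferKernel_pos _ _ _ _).le
  rw [mul_assoc, mul_comm]
  exact mul_le_mul h2 h1 hP0 (Real.exp_pos _).le

/-! ## §2 The integrated cuts -/

/-- Measurability of the far-link indicator as a functional of a pair read off the chain. [folklore] -/
theorem measurable_indicator_far_comp {t : ℝ} {X : Type*} [MeasurableSpace X] {f : X → GaugeConfig 3 L SU2 × GaugeConfig 3 L SU2}
    (hf : Measurable f) :
    Measurable fun x => Set.indicator {p : GaugeConfig 3 L SU2 × GaugeConfig 3 L SU2 |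
      ∃ e, t < frobNorm ((p.1 e : Matrix (Fin 2) (Fin 2) ℂ) - (p.2 e : Matrix (Fin 2) (Fin 2) ℂ))} (fun _ => (1 : ℝ)) (f x) :=
  (measurable_const.indicator (FlatSheet.measurableSet_far t)).comp hf

/-- ★ **Large-action cut in a sector**: `sectorWeight β n z 𝟙[s ≤ S(U_t)] ≤ e^{−βs/2} · M^{n} · M` for every slice `t`, `M = (e^{2β})^{|E|}`.
[cite: SeilerLNP1982, §3] [cite: Luscher1983, §2] -/
theorem sectorWeight_indicator_largeAction_le {β : ℝ} (hβ : 0 ≤ β) (n : ℕ) (z : Fin 3 → Bool) (s : ℝ) (t : Fin (n + 1)) :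
    sectorWeight β n z (fun Us _ => Set.indicator {U : GaugeConfig 3 L SU2 | s ≤ wilsonAction su2Rep U} (fun _ => (1 : ℝ)) (Us t)) ≤
      Real.exp (-(β / 2 * s)) * (Real.exp (2 * β) ^ Fintype.card (Edge 3 L)) ^ n * Real.exp (2 * β) ^ Fintype.card (Edge 3 L) := by
  haveI : SecondCountableTopology SU2 := secondCountableTopology_su2
  have hA : MeasurableSet {U : GaugeConfig 3 L SU2 | s ≤ wilsonAction su2Rep U} :=
    measurableSet_le measurable_const (continuous_wilsonAction su2Rep continuous_su2Rep).measurable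
  have hF : Measurable (uncurry fun (Us : Fin (n + 1) → GaugeConfig 3 L SU2) (_g : Site 3 L → SU2) =>
      Set.indicator {U : GaugeConfig 3 L SU2 | s ≤ wilsonAction su2Rep U} (fun _ => (1 : ℝ)) (Us t)) := by
    have h1 : Measurable fun p : (Fin (n + 1) → GaugeConfig 3 L SU2) × (Site 3 L → SU2) => p.1 t := (measurable_pi_apply t).comp measurable_fst
    exact (measurable_const.indicator hA).comp h1
  exact sectorWeight_le_of_pointwise β n z hF (fun Us _ => abs_indicator_one_le _ (Us t)) fun Us g =>
    seamChain_mul_indicator_largeAction_le hβ n z s t Us g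

/-- ★ **Far-link cut on an interior bond of a sector**: `sectorWeight β n z 𝟙[bond i has a t-far link] ≤ e^{β(2|E|−t²/2)} · M^{n}`. [cite: SeilerLNP1982, §3] -/
theorem sectorWeight_indicator_far_le {β : ℝ} (hβ : 0 ≤ β) {t : ℝ} (ht : 0 ≤ t) {n : ℕ} (z : Fin 3 → Bool) (i : Fin n) :
    sectorWeight β n z (fun Us _ => Set.indicator {p : GaugeConfig 3 L SU2 × GaugeConfig 3 L SU2 |
        ∃ e, t < frobNorm ((p.1 e : Matrix (Fin 2) (Fin 2) ℂ) - (p.2 e : Matrix (Fin 2) (Fin 2) ℂ))} (fun _ => (1 : ℝ)) (Us i.castSucc, Us i.succ)) ≤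
      Real.exp (β * (2 * (Fintype.card (Edge 3 L) : ℝ) - t ^ 2 / 2)) * (Real.exp (2 * β) ^ Fintype.card (Edge 3 L)) ^ n := by
  have hf : Measurable fun p : (Fin (n + 1) → GaugeConfig 3 L SU2) × (Site 3 L → SU2) => (p.1 i.castSucc, p.1 i.succ) :=
    ((measurable_pi_apply i.castSucc).comp measurable_fst).prodMk ((measurable_pi_apply i.succ).comp measurable_fst)
  have hF := measurable_indicator_far_comp (L := L) (t := t) hf
  exact sectorWeight_le_of_pointwise β n z hF (fun Us _ => abs_indicator_one_le _ _) fun Us g => seamChain_mul_indicator_far_le hβ ht z i Us g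

/-- ★ **Far-link cut ON THE SEAM BOND of a sector**: `sectorWeight β n z 𝟙[the seam pair (U_n, g·tw_z U_0) has a t-far link] ≤ e^{β(2|E|−t²/2)} · M^{n}`.
[cite: SeilerLNP1982, §3] [cite: tHooft1979] -/
theorem sectorWeight_indicator_seamFar_le {β : ℝ} (hβ : 0 ≤ β) {t : ℝ} (ht : 0 ≤ t) (n : ℕ) (z : Fin 3 → Bool) :
    sectorWeight β n z (fun Us g => Set.indicator {p : GaugeConfig 3 L SU2 × GaugeConfig 3 L SU2 |
        ∃ e, t < frobNorm ((p.1 e : Matrix (Fin 2) (Fin 2) ℂ) - (p.2 e : Matrix (Fin 2) (Fin 2) ℂ))} (fun _ => (1 : ℝ))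
        (Us (Fin.last n), gaugeTransform g (twist3 z (Us 0)))) ≤
      Real.exp (β * (2 * (Fintype.card (Edge 3 L) : ℝ) - t ^ 2 / 2)) * (Real.exp (2 * β) ^ Fintype.card (Edge 3 L)) ^ n := by
  have h0 : Measurable fun p : (Fin (n + 1) → GaugeConfig 3 L SU2) × (Site 3 L → SU2) => (p.2, p.1 0) :=
    measurable_snd.prodMk ((measurable_pi_apply 0).comp measurable_fst)
  have h1 := (measurable_act_uncurry (L := L) z).comp h0
  have hf : Measurable fun p : (Fin (n + 1) → GaugeConfig 3 L SU2) × (Site 3 L → SU2) => (p.1 (Fin.last n), gaugeTransform p.2 (twist3 z (p.1 0))) :=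
    ((measurable_pi_apply (Fin.last n)).comp measurable_fst).prodMk h1
  have hF := measurable_indicator_far_comp (L := L) (t := t) hf
  exact sectorWeight_le_of_pointwise β n z hF (fun Us g => abs_indicator_one_le _ _) fun Us g => seamChain_mul_indicator_seamFar_le hβ ht n z Us g

/-! ## §3 The floor for the zero-flux trace and the normalised cuts -/

/-- `λ₀^{n+1} ≤ Z_phys(L, β, n+1)` for `n ≥ 1`, `β ≥ 1` (trace formula; all transfer levels are non-negative). [cite: MontvayMunster1994, (3.145)] -/
theorem pow_levelValue_zero_le_physTraceSucc {n : ℕ} (hn : 1 ≤ n) {β : ℝ} (hβ : 1 ≤ β) :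
    levelValue su2Rep L β 0 ^ (n + 1) ≤ physTraceSucc L β n := by
  have hβ0 : 0 < β := by linarith
  have hS := traceFormula_all L β (n + 1) hβ (by omega)
  have h : physTrace L β (n + 1) = physTraceSucc L β n := by simp [physTrace]
  rw [← h]
  exact le_hasSum hS 0 fun k _ => pow_nonneg (levelValue_su2Rep_pos hβ0 k).le _

/-- **Polynomial floor for the zero-flux trace**: `(M · (β^N)⁻¹)^{n+1} ≤ Z_phys(L, β, n+1)`, `N = 8|P| + 97|E|`, for `β ≥ max(9, 4/w₀)`, `n ≥ 1`.
[cite: Luscher1983, §2] -/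
theorem floor_le_physTraceSucc {n : ℕ} (hn : 1 ≤ n) {β : ℝ} (hβ9 : 9 ≤ β) (hβw : 4 / (Real.exp (-(1 / 2 : ℝ)) * (8 / (3 * π ^ 3))) ≤ β) :
    (Real.exp (2 * β) ^ Fintype.card (Edge 3 L) * (β ^ (8 * Fintype.card (Plaquette 3 L) + 97 * Fintype.card (Edge 3 L)))⁻¹) ^ (n + 1) ≤
      physTraceSucc L β n :=
  (pow_le_pow_left₀ (by positivity) (levelValue_zero_ge_rpow hβ9 hβw) _).trans (pow_levelValue_zero_le_physTraceSucc hn (by linarith))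

/-- `M^{n+1} ≤ (β^N)^{n+1} · Z_phys(L, β, n+1)` (the floor rearranged). [cite: Luscher1983, §2] -/
theorem pow_le_rpow_pow_mul_physTraceSucc {n : ℕ} (hn : 1 ≤ n) {β : ℝ} (hβ9 : 9 ≤ β) (hβw : 4 / (Real.exp (-(1 / 2 : ℝ)) * (8 / (3 * π ^ 3))) ≤ β) :
    (Real.exp (2 * β) ^ Fintype.card (Edge 3 L)) ^ (n + 1) ≤
      (β ^ (8 * Fintype.card (Plaquette 3 L) + 97 * Fintype.card (Edge 3 L))) ^ (n + 1) * physTraceSucc L β n := by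
  have hβ0 : 0 < β := by linarith
  set M : ℝ := Real.exp (2 * β) ^ Fintype.card (Edge 3 L) with hM
  set N : ℕ := 8 * Fintype.card (Plaquette 3 L) + 97 * Fintype.card (Edge 3 L) with hN
  have hfloor := floor_le_physTraceSucc (L := L) hn hβ9 hβw
  have h := mul_le_mul_of_nonneg_left hfloor (by positivity : (0 : ℝ) ≤ (β ^ N) ^ (n + 1))
  have e : (β ^ N) ^ (n + 1) * (M * (β ^ N)⁻¹) ^ (n + 1) = M ^ (n + 1) := by
    rw [mul_pow, ← mul_assoc, mul_comm ((β ^ N) ^ (n + 1)), mul_assoc, ← mul_pow, mul_inv_cancel₀ (pow_ne_zero _ hβ0.ne'), one_pow, mul_one]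
  rw [e] at h
  exact h

/-- ★ **Normalised large-action cut**: `sectorWeight β n z 𝟙[s ≤ S(U_t)] ≤ e^{−βs/2} · (β^N)^{n+1} · Z_phys(L, β, n+1)` (`β ≥ max(9, 4/w₀)`, `n ≥ 1`).
With `βs/2 ≥ ((n+1)N + a) log β` the slices of action `≥ s` are `β^{−a}`-negligible in every sector. [cite: Luscher1983, §2] -/
theorem sectorWeight_indicator_largeAction_le_floor {n : ℕ} (hn : 1 ≤ n) {β : ℝ} (hβ9 : 9 ≤ β)
    (hβw : 4 / (Real.exp (-(1 / 2 : ℝ)) * (8 / (3 * π ^ 3))) ≤ β) (z : Fin 3 → Bool) (s : ℝ) (t : Fin (n + 1)) :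
    sectorWeight β n z (fun Us _ => Set.indicator {U : GaugeConfig 3 L SU2 | s ≤ wilsonAction su2Rep U} (fun _ => (1 : ℝ)) (Us t)) ≤
      Real.exp (-(β / 2 * s)) * (β ^ (8 * Fintype.card (Plaquette 3 L) + 97 * Fintype.card (Edge 3 L))) ^ (n + 1) * physTraceSucc L β n := by
  have hβ0 : 0 ≤ β := by linarith
  have hcut := sectorWeight_indicator_largeAction_le (L := L) hβ0 n z s t
  have hkey := pow_le_rpow_pow_mul_physTraceSucc (L := L) hn hβ9 hβw
  rw [mul_assoc, ← pow_succ] at hcut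
  calc _ ≤ Real.exp (-(β / 2 * s)) * (Real.exp (2 * β) ^ Fintype.card (Edge 3 L)) ^ (n + 1) := hcut
    _ ≤ _ := by rw [mul_assoc]; exact mul_le_mul_of_nonneg_left hkey (Real.exp_pos _).le

/-- `e^{β(2|E| − t²/2)} · M^n = e^{−βt²/2} · M^{n+1}`. [folklore] -/
theorem exp_far_mul_pow_eq (β t : ℝ) (n : ℕ) :
    Real.exp (β * (2 * (Fintype.card (Edge 3 L) : ℝ) - t ^ 2 / 2)) * (Real.exp (2 * β) ^ Fintype.card (Edge 3 L)) ^ n =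
      Real.exp (-(β * t ^ 2 / 2)) * (Real.exp (2 * β) ^ Fintype.card (Edge 3 L)) ^ (n + 1) := by
  have h : Real.exp (β * (2 * (Fintype.card (Edge 3 L) : ℝ) - t ^ 2 / 2)) = Real.exp (2 * β) ^ Fintype.card (Edge 3 L) * Real.exp (-(β * t ^ 2 / 2)) := by
    rw [← Real.exp_nat_mul, ← Real.exp_add]; congr 1; ring
  rw [h, pow_succ]; ring

/-- ★ **Normalised far-link cut (interior bond)**: `sectorWeight β n z 𝟙[bond i t-far] ≤ e^{−βt²/2} · (β^N)^{n+1} · Z_phys(L, β, n+1)`. [cite: Luscher1983, §2] -/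
theorem sectorWeight_indicator_far_le_floor {n : ℕ} (hn : 1 ≤ n) {β : ℝ} (hβ9 : 9 ≤ β)
    (hβw : 4 / (Real.exp (-(1 / 2 : ℝ)) * (8 / (3 * π ^ 3))) ≤ β) {t : ℝ} (ht : 0 ≤ t) (z : Fin 3 → Bool) (i : Fin n) :
    sectorWeight β n z (fun Us _ => Set.indicator {p : GaugeConfig 3 L SU2 × GaugeConfig 3 L SU2 |
        ∃ e, t < frobNorm ((p.1 e : Matrix (Fin 2) (Fin 2) ℂ) - (p.2 e : Matrix (Fin 2) (Fin 2) ℂ))} (fun _ => (1 : ℝ)) (Us i.castSucc, Us i.succ)) ≤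
      Real.exp (-(β * t ^ 2 / 2)) * (β ^ (8 * Fintype.card (Plaquette 3 L) + 97 * Fintype.card (Edge 3 L))) ^ (n + 1) * physTraceSucc L β n := by
  have hβ0 : 0 ≤ β := by linarith
  have hcut := sectorWeight_indicator_far_le (L := L) hβ0 ht z i
  rw [exp_far_mul_pow_eq] at hcut
  have hkey := pow_le_rpow_pow_mul_physTraceSucc (L := L) hn hβ9 hβw
  calc _ ≤ Real.exp (-(β * t ^ 2 / 2)) * (Real.exp (2 * β) ^ Fintype.card (Edge 3 L)) ^ (n + 1) := hcut
    _ ≤ _ := by rw [mul_assoc]; exact mul_le_mul_of_nonneg_left hkey (Real.exp_pos _).le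

/-- ★ **Normalised far-link cut (SEAM bond)**: `sectorWeight β n z 𝟙[seam pair t-far] ≤ e^{−βt²/2} · (β^N)^{n+1} · Z_phys(L, β, n+1)` — on the window, seam
pairs `(U_n, g·tw_z U_0)` with a link farther than `t ≍ √((n+1)N log β / β)` are negligible: the seam closeness used by the pinning lemmas
(`FlatSheet.two_sub_le_polDist_of_twisted_sector`). [cite: Luscher1983, §2] [cite: tHooft1979] -/
theorem sectorWeight_indicator_seamFar_le_floor {n : ℕ} (hn : 1 ≤ n) {β : ℝ} (hβ9 : 9 ≤ β)
    (hβw : 4 / (Real.exp (-(1 / 2 : ℝ)) * (8 / (3 * π ^ 3))) ≤ β) {t : ℝ} (ht : 0 ≤ t) (z : Fin 3 → Bool) :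
    sectorWeight β n z (fun Us g => Set.indicator {p : GaugeConfig 3 L SU2 × GaugeConfig 3 L SU2 |
        ∃ e, t < frobNorm ((p.1 e : Matrix (Fin 2) (Fin 2) ℂ) - (p.2 e : Matrix (Fin 2) (Fin 2) ℂ))} (fun _ => (1 : ℝ))
        (Us (Fin.last n), gaugeTransform g (twist3 z (Us 0)))) ≤
      Real.exp (-(β * t ^ 2 / 2)) * (β ^ (8 * Fintype.card (Plaquette 3 L) + 97 * Fintype.card (Edge 3 L))) ^ (n + 1) * physTraceSucc L β n := by
  have hβ0 : 0 ≤ β := by linarith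
  have hcut := sectorWeight_indicator_seamFar_le (L := L) hβ0 ht n z
  rw [exp_far_mul_pow_eq] at hcut
  have hkey := pow_le_rpow_pow_mul_physTraceSucc (L := L) hn hβ9 hβw
  calc _ ≤ Real.exp (-(β * t ^ 2 / 2)) * (Real.exp (2 * β) ^ Fintype.card (Edge 3 L)) ^ (n + 1) := hcut
    _ ≤ _ := by rw [mul_assoc]; exact mul_le_mul_of_nonneg_left hkey (Real.exp_pos _).le

end Summit.QuantumFields.YangMills.Theorems.FemtoTransferGap.TT

end
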